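import Summits.CriticalPhenomena.PercolationContinuityZ3.Theorems.Transplant.FKConnectivityAllQClusterDom
import Summits.CriticalPhenomena.PercolationContinuityZ3.Theorems.PercNearOneGluingNoHeavyLowerTailFKCSHPhiMonotoneCluster
import Literature.Probability.Percolation.KozmaNitzanClusterProperty
import HarnessLib

/-!
# Connectivity correlation inequalities for `φ_{w,q}`, every `q > 0` — MM ⇒ CA: stochastic monotonicity of the cluster in an
# adjacent edge IMPLIES positive association of the cluster (hence the hub inequality)

Support file (`--supports stmt-CriticalPhenomena-4575`), FK sub-lane `prim-bschramm-fk-1` (gen 8) of the post-continuity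
programme; builds on p205010 (kernel theorem, internal audit signed; external expert review pending).  No definitions, no named
facts, no sorries; standard axioms.

THEOREM (`clusterAssocOn_of_clusterDomAdjOn`, every `q > 0`): if on the vertex type `V` the law of the cluster `C_x` of a vertex is
stochastically increasing in the state of every pair AT `x` (fk-1 g7's node MM, `FK.ClusterDomAdjOn V q`:
`φ_{w[xz↦0],q}(C_x ∈ 𝒰) ≤ φ_{w[xz↦1],q}(C_x ∈ 𝒰)` for all `w, x, z` and up-sets `𝒰`), then the law of `C_x` is positively associated
(fk-1 g7's node CA, `FK.ClusterAssocOn V q`: `φ(C_x ∈ 𝒰)·φ(C_x ∈ 𝒱) ≤ φ(C_x ∈ 𝒰 ∩ 𝒱)`).  Consequently the single conjecture node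
`FK.ClusterDomAdjFKPos` implies ALL FOUR of `EdgeNegCorrAdjFKLtOne` / `HubCovBoundFKLtOne` (g7) and `ClusterAssocFKPos` / `HubFKPos`
(this file: `clusterAssocFKPos_of_clusterDomAdjFKPos`, `hubFKPos_of_clusterDomAdjFKPos`) — i.e. both the adjacent case of Grimmett's
negative-correlation conjecture and Ayyer–Linusson–Ravichandran's hub inequality (13)/(15) for every `q ∈ (0,1)`.

PROOF.  Harris' inequality by induction on coordinates, run on the pairs at the cluster: induct on the number of undetermined pairs
(parameter strictly between `0` and `1`).  If some undetermined pair `f` meets the weight-1 cluster `A` of `x` — say `f ∋ v` with `v`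
joined to `x` by parameter-1 pairs — then `C_x = C_v` on the support of each of `φ_w`, `φ_{w[f↦1]}`, `φ_{w[f↦0]}` (parameter-1 pairs are
open almost surely), the one-point decomposition `φ_w = φ_w(f)·φ_{w[f↦1]} + (1−φ_w(f))·φ_{w[f↦0]}` (Grimmett's Thm (3.7)) and the
induction hypothesis for the two revealed parameter vectors leave the cross term
`φ_w(f)(1−φ_w(f))·(φ_{w[f↦1]}(A) − φ_{w[f↦0]}(A))·(φ_{w[f↦1]}(B) − φ_{w[f↦0]}(B)) ≥ 0`, whose two brackets are nonnegative by MM AT `v`.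
If no undetermined pair meets `A`, then `C_x = A` on the support of `φ_w` (fk-1 g3's `reachY_iff_of_support`) and both sides are products
of constants.  No sign of `1 − q` is used: the implication holds for every `q > 0` (for `q ≥ 1` both sides are theorems, FKG).
[cite: Grimmett2006, Thm. (2.19)/(3.8) proof by induction (pp. 26–27, 39); Thm. (3.7) (p. 39); §3.9 (pp. 63–65)]
[cite: AyyerLinussonRavichandran2025, §7 eq. (13), Conj. 7.1 (p. 22)] [cite: Wagner2006, Conj. 5.3 (p. 13)]
-/

noncomputable section

namespace Summit.CriticalPhenomena.PercolationContinuityZ3.Theorems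

namespace FK

open MeasureTheory Set Literature.Probability.LatticeModels Literature.Probability.Percolation
open scoped Classical
open BHK2006 DecisionTree HullPort

variable {V : Type*} [Fintype V]

/-! ### Bridges: events as sum-level expectations, revealed parameters -/

/-- `φ_w(D) = E_w[1_D]` at sum level. [cite: Grimmett2006, §1.4 eq. (1.20) (p. 15)] -/
theorem real_eq_rcE_ind (w : Sym2 V → unitInterval) {q : ℝ} (hq : 0 < q) (D : Set (BondConfig V)) :
    (rcMeasureW w q ∅).real D = rcE w q (ind D) :=
  rcMeasureW_real_eq_sum_rcMass w hq D

omit [Fintype V] in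
/-- `w[f ↦ 1]` is `setW w f true`. [folklore] -/
theorem setW_true_eq (w : Sym2 V → unitInterval) (f : Sym2 V) : setW w f true = Function.update w f 1 := by
  funext e; by_cases h : e = f
  · subst h; simp [setW]
  · simp [setW, Function.update_of_ne h]

omit [Fintype V] in
/-- `w[f ↦ 0]` is `setW w f false`. [folklore] -/
theorem setW_false_eq (w : Sym2 V → unitInterval) (f : Sym2 V) : setW w f false = Function.update w f 0 := by
  funext e; by_cases h : e = f
  · subst h; simp [setW]
  · simp [setW, Function.update_of_ne h]

/-- **One-point decomposition of an event**: `φ_w(D) = φ_w(f)·φ_{w[f↦1]}(D) + (1 − φ_w(f))·φ_{w[f↦0]}(D)`.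
[cite: Grimmett2006, Thm. (3.7) (p. 39)] -/
theorem real_opd (w : Sym2 V → unitInterval) {q : ℝ} (hq : 0 < q) (f : Sym2 V) (D : Set (BondConfig V)) :
    (rcMeasureW w q ∅).real D =
      popen w q f * (rcMeasureW (setW w f true) q ∅).real D + (1 - popen w q f) * (rcMeasureW (setW w f false) q ∅).real D := by
  rw [real_eq_rcE_ind w hq, real_eq_rcE_ind _ hq, real_eq_rcE_ind _ hq]
  exact rcE_opd w hq f (ind D)

/-- The inductive step of Harris' inequality: a convex combination of two associated pairs with co-monotone marginals is associated.
[cite: Grimmett2006, Thm. (2.19) proof (pp. 26–27)] -/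
theorem assoc_step {l a₁ a₀ b₁ b₀ c₁ c₀ : ℝ} (hl0 : 0 ≤ l) (hl1 : l ≤ 1) (h₁ : a₁ * b₁ ≤ c₁) (h₀ : a₀ * b₀ ≤ c₀)
    (ha : a₀ ≤ a₁) (hb : b₀ ≤ b₁) :
    (l * a₁ + (1 - l) * a₀) * (l * b₁ + (1 - l) * b₀) ≤ l * c₁ + (1 - l) * c₀ := by
  have cross : 0 ≤ l * (1 - l) * ((a₁ - a₀) * (b₁ - b₀)) :=
    mul_nonneg (mul_nonneg hl0 (sub_nonneg.2 hl1)) (mul_nonneg (sub_nonneg.2 ha) (sub_nonneg.2 hb))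
  nlinarith [mul_nonneg hl0 (sub_nonneg.2 h₁), mul_nonneg (sub_nonneg.2 hl1) (sub_nonneg.2 h₀), cross]

/-! ### The cluster seen from a surely-joined vertex -/

/-- **On the support of `φ_u`, the cluster of `x` equals the cluster of every vertex `v` joined to `x` by parameter-1 pairs.**
[cite: Grimmett2006, §1.4 eq. (1.20) (p. 15)] -/
theorem ind_clusterIn_eq_of_oneSet_reachable (u : Sym2 V → unitInterval) (q : ℝ) {x v : V}
    (hxv : (openGraph (oneSet u)).Reachable x v) (𝒰 : Set (Set V)) {ω : BondConfig V} (hω : rcMass u q ω ≠ 0) :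
    ind (clusterIn x 𝒰) ω = ind (clusterIn v 𝒰) ω := by
  have hsub : oneSet u ⊆ ω := fun f hf => (mem_of_rcMass_ne_zero u q hω).1 f hf
  have hR : (openGraph ω).Reachable x v := hxv.mono (openGraph_le hsub)
  have hC := KNPreFKG.openCluster_eq_of_reachable hR
  by_cases h : ω ∈ clusterIn x 𝒰
  · have h' : ω ∈ clusterIn v 𝒰 := by
      change openCluster ω v ∈ 𝒰; rw [← hC]; exact h
    rw [ind_of_mem h, ind_of_mem h']
  · have h' : ω ∉ clusterIn v 𝒰 := by
      intro h'; apply h; change openCluster ω x ∈ 𝒰; rw [hC]; exact h'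
    rw [ind_of_not_mem h, ind_of_not_mem h']

/-- Hence the probabilities of `{C_x ∈ 𝒰}`, `{C_v ∈ 𝒰}` (and of their intersections with a second cluster event) agree.
[cite: Grimmett2006, §1.4 eq. (1.20) (p. 15)] -/
theorem real_clusterIn_inter_eq_of_oneSet_reachable (u : Sym2 V → unitInterval) {q : ℝ} (hq : 0 < q) {x v : V}
    (hxv : (openGraph (oneSet u)).Reachable x v) (𝒰 𝒱 : Set (Set V)) :
    (rcMeasureW u q ∅).real (clusterIn x 𝒰 ∩ clusterIn x 𝒱) = (rcMeasureW u q ∅).real (clusterIn v 𝒰 ∩ clusterIn v 𝒱) := by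
  rw [real_eq_rcE_ind u hq, real_eq_rcE_ind u hq]
  refine rcE_congr_support u q fun ω hω => ?_
  rw [ind_inter, ind_inter, ind_clusterIn_eq_of_oneSet_reachable u q hxv 𝒰 hω,
    ind_clusterIn_eq_of_oneSet_reachable u q hxv 𝒱 hω]

/-- Single-event version. [cite: Grimmett2006, §1.4 eq. (1.20) (p. 15)] -/
theorem real_clusterIn_eq_of_oneSet_reachable (u : Sym2 V → unitInterval) {q : ℝ} (hq : 0 < q) {x v : V}
    (hxv : (openGraph (oneSet u)).Reachable x v) (𝒰 : Set (Set V)) :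
    (rcMeasureW u q ∅).real (clusterIn x 𝒰) = (rcMeasureW u q ∅).real (clusterIn v 𝒰) := by
  have h := real_clusterIn_inter_eq_of_oneSet_reachable u hq hxv 𝒰 𝒰
  rwa [inter_self, inter_self] at h

/-- **Deterministic cluster.**  If every pair meeting the weight-1 cluster `A` of `x` is determined (parameter `0` or `1`), then
`φ_w(C_x ∈ 𝒰) = 1[A ∈ 𝒰]`. [cite: Grimmett2006, §1.4 eq. (1.20) (p. 15)] -/
theorem real_clusterIn_of_determined (w : Sym2 V → unitInterval) {q : ℝ} (hq : 0 < q) (x : V)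
    (hA : ∀ f ∈ cut {x} (oneSet w), w f = 0 ∨ w f = 1) (𝒰 : Set (Set V)) :
    (rcMeasureW w q ∅).real (clusterIn x 𝒰) = ind 𝒰 (openCluster (oneSet w) x) := by
  rw [real_eq_rcE_ind w hq]
  have hc : rcE w q (fun _ => ind 𝒰 (openCluster (oneSet w) x)) = ind 𝒰 (openCluster (oneSet w) x) := by
    unfold rcE; rw [← Finset.sum_mul, sum_rcMass w hq, one_mul]
  rw [← hc]
  refine rcE_congr_support w q fun ω hω => ?_
  have hR := reachY_iff_of_support w q {x} hA hω
  have hC : openCluster ω x = openCluster (oneSet w) x := by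
    ext z
    have hz := hR z
    simp only [mem_singleton_iff, exists_eq_left] at hz
    exact hz
  by_cases h : ω ∈ clusterIn x 𝒰
  · rw [ind_of_mem h]
    have h' : openCluster (oneSet w) x ∈ 𝒰 := by rw [← hC]; exact h
    rw [ind_of_mem h']
  · rw [ind_of_not_mem h]
    have h' : openCluster (oneSet w) x ∉ 𝒰 := by rw [← hC]; exact h
    rw [ind_of_not_mem h']

/-! ### MM ⇒ CA -/

/-- **MM ⇒ CA, inductive form**: under `ClusterDomAdjOn V q`, for every parameter vector with `n` undetermined pairs the law of every
cluster `C_x` is positively associated. [cite: Grimmett2006, Thm. (2.19) proof (pp. 26–27); Thm. (3.7) (p. 39)] -/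
theorem clusterAssoc_of_clusterDomAdj_aux {q : ℝ} (hq0 : 0 < q) (h : ClusterDomAdjOn V q) :
    ∀ (n : ℕ) (w : Sym2 V → unitInterval), (undet w).card = n → ∀ (x : V) (𝒰 𝒱 : Set (Set V)),
      IsUpperSet 𝒰 → IsUpperSet 𝒱 →
        (rcMeasureW w q ∅).real (clusterIn x 𝒰) * (rcMeasureW w q ∅).real (clusterIn x 𝒱) ≤
          (rcMeasureW w q ∅).real (clusterIn x 𝒰 ∩ clusterIn x 𝒱) := by
  intro n
  induction n using Nat.strong_induction_on with
  | _ n ih =>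
    intro w hn x 𝒰 𝒱 h𝒰 h𝒱
    by_cases hcase : ∃ f ∈ cut {x} (oneSet w), f ∈ undet w
    · -- an undetermined pair `f ∋ v` meets the weight-1 cluster of `x` at `v`
      obtain ⟨f, ⟨v, hvf, x', hx', hxv⟩, hfu⟩ := hcase
      rw [mem_singleton_iff] at hx'
      subst hx'
      have hf : f = s(v, Sym2.Mem.other hvf) := (Sym2.other_spec hvf).symm
      set b := Sym2.Mem.other hvf with hb
      have hw1 : w f ≠ 1 := fun h1 => (mem_undet_iff w f).1 hfu (Or.inr h1)
      -- `C_x = C_v` a.s. under `w`, `w[f↦1]`, `w[f↦0]`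
      have reach : ∀ bb : Bool, (openGraph (oneSet (setW w f bb))).Reachable x' v := fun bb =>
        hxv.mono (openGraph_le (oneSet_subset_oneSet_setW w hw1 bb))
      -- one-point decompositions
      have eA := real_opd w hq0 f (clusterIn x' 𝒰)
      have eB := real_opd w hq0 f (clusterIn x' 𝒱)
      have eAB := real_opd w hq0 f (clusterIn x' 𝒰 ∩ clusterIn x' 𝒱)
      -- induction hypothesis for the two revealed vectors
      have hlt : ∀ bb : Bool, (undet (setW w f bb)).card < n := fun bb => by
        have h1 := card_undet_setW_le w hfu bb
        have hpos : 0 < (undet w).card := Finset.card_pos.2 ⟨f, hfu⟩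
        omega
      have ih1 := ih _ (hlt true) (setW w f true) rfl x' 𝒰 𝒱 h𝒰 h𝒱
      have ih0 := ih _ (hlt false) (setW w f false) rfl x' 𝒰 𝒱 h𝒰 h𝒱
      -- MM at `v`, transported to `x'`
      have mmA : (rcMeasureW (setW w f false) q ∅).real (clusterIn x' 𝒰) ≤
          (rcMeasureW (setW w f true) q ∅).real (clusterIn x' 𝒰) := by
        rw [real_clusterIn_eq_of_oneSet_reachable _ hq0 (reach false) 𝒰,
          real_clusterIn_eq_of_oneSet_reachable _ hq0 (reach true) 𝒰, setW_false_eq, setW_true_eq, hf]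
        exact h w v b 𝒰 h𝒰
      have mmB : (rcMeasureW (setW w f false) q ∅).real (clusterIn x' 𝒱) ≤
          (rcMeasureW (setW w f true) q ∅).real (clusterIn x' 𝒱) := by
        rw [real_clusterIn_eq_of_oneSet_reachable _ hq0 (reach false) 𝒱,
          real_clusterIn_eq_of_oneSet_reachable _ hq0 (reach true) 𝒱, setW_false_eq, setW_true_eq, hf]
        exact h w v b 𝒱 h𝒱
      rw [eA, eB, eAB]
      exact assoc_step (popen_nonneg w hq0 f) (popen_le_one w hq0 f) ih1 ih0 mmA mmB
    · -- no undetermined pair meets the weight-1 cluster: `C_x` is deterministic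
      push Not at hcase
      have hA : ∀ f ∈ cut {x} (oneSet w), w f = 0 ∨ w f = 1 := fun f hf => by
        have := hcase f hf; rw [mem_undet_iff] at this; push Not at this
        exact this
      have hinter : clusterIn x 𝒰 ∩ clusterIn x 𝒱 = clusterIn x (𝒰 ∩ 𝒱) := by
        ext ω; simp [clusterIn]
      rw [hinter, real_clusterIn_of_determined w hq0 x hA 𝒰, real_clusterIn_of_determined w hq0 x hA 𝒱,
        real_clusterIn_of_determined w hq0 x hA (𝒰 ∩ 𝒱), ind_inter]

/-- **MM ⇒ CA** (every `q > 0`): stochastic monotonicity of the cluster of a vertex in the pairs at that vertex implies positive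
association of the cluster. [cite: Grimmett2006, Thm. (2.19) proof (pp. 26–27); Thm. (3.7) (p. 39); §3.9 (pp. 63–65)] -/
theorem clusterAssocOn_of_clusterDomAdjOn {q : ℝ} (hq0 : 0 < q) (h : ClusterDomAdjOn V q) : ClusterAssocOn V q :=
  fun w x 𝒰 𝒱 h𝒰 h𝒱 => clusterAssoc_of_clusterDomAdj_aux hq0 h _ w rfl x 𝒰 𝒱 h𝒰 h𝒱

/-- `ClusterDomAdjFK q → ClusterAssocFK q` (every `q > 0`). [cite: Grimmett2006, §3.9 (pp. 63–65)] -/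
theorem clusterAssocFK_of_clusterDomAdjFK {q : ℝ} (hq0 : 0 < q) (h : ClusterDomAdjFK q) : ClusterAssocFK q :=
  fun n => clusterAssocOn_of_clusterDomAdjOn hq0 (h n)

/-- **Conjecture nodes: `ClusterDomAdjFKPos → ClusterAssocFKPos`.** [cite: Grimmett2006, §3.9 (pp. 63–65)]
[cite: AyyerLinussonRavichandran2025, §7 eq. (13), Conj. 7.1 (p. 22)] -/
theorem clusterAssocFKPos_of_clusterDomAdjFKPos (h : ClusterDomAdjFKPos) : ClusterAssocFKPos :=
  fun q hq0 => clusterAssocFK_of_clusterDomAdjFK hq0 (h q hq0)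

/-- **MM ⇒ the hub inequality** on the vertex type `V` (every `q > 0`): `φ(o ↔ a)·φ(b ↔ a) ≤ φ(o ↔ a ↔ b)`.
[cite: AyyerLinussonRavichandran2025, §7 eq. (13) (p. 22)] -/
theorem hubUnder_of_clusterDomAdjOn {q : ℝ} (hq0 : 0 < q) (h : ClusterDomAdjOn V q) (w : Sym2 V → unitInterval) (o a b : V) :
    HubUnder (rcMeasureW w q ∅) o a b :=
  hubUnder_of_clusterAssocOn hq0 (clusterAssocOn_of_clusterDomAdjOn hq0 h) w o a b

/-- **Conjecture nodes: `ClusterDomAdjFKPos → HubFKPos`** — so the single node MM implies `EdgeNegCorrAdjFKLtOne`,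
`HubCovBoundFKLtOne`, `ClusterAssocFKPos` and `HubFKPos`. [cite: AyyerLinussonRavichandran2025, §7 eq. (13), Conj. 7.1 (p. 22)]
[cite: Grimmett2006, §3.9 (pp. 63–65)] -/
theorem hubFKPos_of_clusterDomAdjFKPos (h : ClusterDomAdjFKPos) : HubFKPos :=
  hubFKPos_of_clusterAssocFKPos (clusterAssocFKPos_of_clusterDomAdjFKPos h)

end FK

end Summit.CriticalPhenomena.PercolationContinuityZ3.Theorems

end
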